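import Mathlib
import HarnessLib

/-!
# Helper `helper_span_eq_top_of_gram_eq` of line `Sketch` for crux
# `ConvexBisection.PlanarAcyclicBisectionRigidity` (item stmt-SmoothPoincare4-15086)

**The torsion sector is empty for at most three holes.**  Abelianised arc data of a planar Stein
bisection: every vanishing cycle `c` has a nonzero `0/1` TYPE vector `s(c) ∈ ℤⁿ` (the holes it
encloses); two positive factorisations `A`, `B` of one planar mapping class have the same Gram sum
`Σ_{c ∈ A} s(c) s(c)ᵀ = Σ_{c ∈ B} s(c) s(c)ᵀ`; simple connectivity of the closed manifold says that
the types of `A ++ B` span `ℤⁿ`; and "the types of `A` span `ℤⁿ`" is `H₁(X_A; ℤ) = 0`.  The theorem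
`helper_span_eq_top_of_gram_eq`: for `n ≤ 3` these hypotheses force the types of `A` alone to
span `ℤⁿ`.  (False for `n = 4`; not attempted.)

Proof (elementary linear algebra over `ℤ`, `GramSpan.*`):
* Gram identity `Σ_{s ∈ L} ⟪w, s⟫² = Σ_{i,j} wᵢ wⱼ (Σ_{s ∈ L} sᵢ sⱼ)` (`sum_sq_dotProduct`), so equal
  Gram sums give `Σ_{s ∈ A} ⟪w, s⟫² = Σ_{s ∈ B} ⟪w, s⟫²` for every functional `w`; a functional
  killing `A` kills `B` (`dot_eq_zero_of_gram_eq`);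
* a functional that is `m`-divisible on a spanning set is `m`-divisible on the standard basis
  (`dvd_apply_of_span_eq_top`, `Submodule.span_induction`);
* `n = 3`, `A = [a, b, c]`: brute force over the `2⁹` Boolean matrices (`trichotomy_fin_three`,
  `decide`): either `det = ±1` (then the columns span, explicit adjugate, `span_eq_top_of_det_three`),
  or an explicit nonzero `w ∈ {0, ±1}³` is orthogonal to `a, b, c` (then `w` kills `A ++ B`,
  contradicting the spanning hypothesis), or `a, b, c` all have weight `2` (then with `w = (1,1,1)`
  the three squares `⟪w, s⟫²`, `s ∈ B`, sum to `12`, which by brute force forces every `s ∈ B` to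
  have weight `2` as well (`weights_of_sum_sq_eq_twelve`); so `⟪w, ·⟫` is even on `A ++ B`, hence
  on `e₀`, i.e. `2 ∣ 1`);
* `n = 2`: the same with `det ∈ {0, ±1}` (`dichotomy_fin_two`, `span_eq_top_of_det_two`);
  `n = 1`: the single type is `e₀`; `n = 0`: trivial.
Uses nothing unproved (Mathlib only).
-/

-- the prescribed namespace `Summit.<S>.<P>.…` repeats `SmoothPoincare4` (S = P = SmoothPoincare4)
set_option linter.dupNamespace false

open Matrix

namespace Summit.SmoothPoincare4.SmoothPoincare4.Theorems.PlanarAcyclicBisectionRigidity.Sketch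

namespace GramSpan

variable {n : ℕ}

/-! ## Spanning sets of `ℤⁿ` and functionals -/

/-- If every standard basis vector `eᵢ = Pi.single i 1` lies in the `ℤ`-span of `S ⊆ ℤⁿ`, then `S`
spans `ℤⁿ`. [folklore] -/
theorem span_eq_top_of_single_mem {S : Set (Fin n → ℤ)}
    (h : ∀ i, Pi.single i 1 ∈ Submodule.span ℤ S) : Submodule.span ℤ S = ⊤ := by
  refine eq_top_iff.mpr ?_
  rw [← (Pi.basisFun ℤ (Fin n)).span_eq, Submodule.span_le]
  rintro _ ⟨i, rfl⟩
  rw [Pi.basisFun_apply]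
  exact h i

/-- A functional `⟪w, ·⟫` on `ℤⁿ` whose values on a spanning set `S` are divisible by `m` has all
its coordinates `wᵢ = ⟪w, eᵢ⟫` divisible by `m` (`m = 0`: a functional killing a spanning set is
zero; `m = 2`: parity version). [folklore] -/
theorem dvd_apply_of_span_eq_top {S : Set (Fin n → ℤ)} (hS : Submodule.span ℤ S = ⊤) (m : ℤ)
    (w : Fin n → ℤ) (h : ∀ s ∈ S, m ∣ w ⬝ᵥ s) (i : Fin n) : m ∣ w i := by
  have key : ∀ x ∈ Submodule.span ℤ S, m ∣ w ⬝ᵥ x := by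
    intro x hx
    induction hx using Submodule.span_induction with
    | mem x hx => exact h x hx
    | zero => simp
    | add x y _ _ hx hy => rw [dotProduct_add]; exact dvd_add hx hy
    | smul a x _ hx => rw [dotProduct_smul, smul_eq_mul]; exact Dvd.dvd.mul_left hx a
  have hi := key (Pi.single i 1) (Submodule.eq_top_iff'.1 hS _)
  rwa [dotProduct_single_one] at hi

/-! ## The Gram identity and its consequence -/

/-- Gram identity: `Σ_{s ∈ L} ⟪w, s⟫² = Σ_{i,j} wᵢ wⱼ (Σ_{s ∈ L} sᵢ sⱼ)`. [folklore] -/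
theorem sum_sq_dotProduct (w : Fin n → ℤ) (L : List (Fin n → ℤ)) :
    (L.map fun s => (w ⬝ᵥ s) ^ 2).sum = ∑ i, ∑ j, w i * w j * (L.map fun s => s i * s j).sum := by
  induction L with
  | nil => simp
  | cons s L ih =>
    simp only [List.map_cons, List.sum_cons, ih, mul_add, Finset.sum_add_distrib]
    congr 1
    rw [sq, dotProduct, Finset.sum_mul_sum]
    exact Finset.sum_congr rfl fun i _ => Finset.sum_congr rfl fun j _ => by ring

/-- Equal Gram sums give equal sums of squares of the values of any functional:
`Σ_{s ∈ A} ⟪w, s⟫² = Σ_{s ∈ B} ⟪w, s⟫²`. [folklore] -/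
theorem sum_sq_eq_of_gram_eq {sA sB : List (Fin n → ℤ)}
    (hgram : ∀ i j : Fin n, (sA.map fun s => s i * s j).sum = (sB.map fun s => s i * s j).sum)
    (w : Fin n → ℤ) :
    (sA.map fun s => (w ⬝ᵥ s) ^ 2).sum = (sB.map fun s => (w ⬝ᵥ s) ^ 2).sum := by
  rw [sum_sq_dotProduct, sum_sq_dotProduct]
  exact Finset.sum_congr rfl fun i _ => Finset.sum_congr rfl fun j _ => by rw [hgram]

/-- A functional killing every `s ∈ A` kills every `s ∈ B` when the Gram sums agree (a sum of
squares of integers vanishes only termwise). [folklore] -/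
theorem dot_eq_zero_of_gram_eq {sA sB : List (Fin n → ℤ)}
    (hgram : ∀ i j : Fin n, (sA.map fun s => s i * s j).sum = (sB.map fun s => s i * s j).sum)
    (w : Fin n → ℤ) (hw : ∀ s ∈ sA, w ⬝ᵥ s = 0) : ∀ s ∈ sB, w ⬝ᵥ s = 0 := by
  have hsq := sum_sq_eq_of_gram_eq hgram w
  have h0 : (sA.map fun s => (w ⬝ᵥ s) ^ 2).sum = 0 := by
    refine List.sum_eq_zero ?_
    intro x hx
    obtain ⟨s, hs, rfl⟩ := List.mem_map.1 hx
    simp [hw s hs]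
  intro s hs
  have hnn : ∀ x ∈ sB.map fun s => (w ⬝ᵥ s) ^ 2, 0 ≤ x := by
    intro x hx
    obtain ⟨t, -, rfl⟩ := List.mem_map.1 hx
    positivity
  have hle : (w ⬝ᵥ s) ^ 2 ≤ (sB.map fun s => (w ⬝ᵥ s) ^ 2).sum :=
    List.single_le_sum hnn _ (List.mem_map.2 ⟨s, hs, rfl⟩)
  rw [← hsq, h0] at hle
  exact (pow_eq_zero_iff two_ne_zero).1 (le_antisymm hle (sq_nonneg _))

/-! ## Brute force over `0/1` matrices -/

/-- A `0/1` integer is `cond β 1 0` for a Boolean `β`. [folklore] -/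
theorem exists_bool_of_zero_or_one {x : ℤ} (h : x = 0 ∨ x = 1) : ∃ β : Bool, x = cond β 1 0 := by
  rcases h with rfl | rfl
  exacts [⟨false, rfl⟩, ⟨true, rfl⟩]

/-- Brute force over the `2⁹` Boolean `3 × 3` matrices with columns `a, b, c`: either `det = ±1`,
or one of nine explicit nonzero vectors `w ∈ {0, ±1}³` is orthogonal to all three columns, or
every column has weight `2` (the case `|det| = 2`). [folklore] -/
theorem trichotomy_fin_three {a0 a1 a2 b0 b1 b2 c0 c1 c2 : ℤ}
    (ha0 : a0 = 0 ∨ a0 = 1) (ha1 : a1 = 0 ∨ a1 = 1) (ha2 : a2 = 0 ∨ a2 = 1)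
    (hb0 : b0 = 0 ∨ b0 = 1) (hb1 : b1 = 0 ∨ b1 = 1) (hb2 : b2 = 0 ∨ b2 = 1)
    (hc0 : c0 = 0 ∨ c0 = 1) (hc1 : c1 = 0 ∨ c1 = 1) (hc2 : c2 = 0 ∨ c2 = 1) :
    (a0 * (b1 * c2 - b2 * c1) - b0 * (a1 * c2 - a2 * c1) + c0 * (a1 * b2 - a2 * b1) = 1 ∨
      a0 * (b1 * c2 - b2 * c1) - b0 * (a1 * c2 - a2 * c1) + c0 * (a1 * b2 - a2 * b1) = -1) ∨
    (∃ t ∈ ([(1, 0, 0), (0, 1, 0), (0, 0, 1), (1, -1, 0), (1, 0, -1), (0, 1, -1), (1, 1, -1),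
        (1, -1, 1), (-1, 1, 1)] : List (ℤ × ℤ × ℤ)),
      (t.1 ≠ 0 ∨ t.2.1 ≠ 0 ∨ t.2.2 ≠ 0) ∧
      t.1 * a0 + t.2.1 * a1 + t.2.2 * a2 = 0 ∧
      t.1 * b0 + t.2.1 * b1 + t.2.2 * b2 = 0 ∧
      t.1 * c0 + t.2.1 * c1 + t.2.2 * c2 = 0) ∨
    (a0 + a1 + a2 = 2 ∧ b0 + b1 + b2 = 2 ∧ c0 + c1 + c2 = 2) := by
  obtain ⟨a0, rfl⟩ := exists_bool_of_zero_or_one ha0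
  obtain ⟨a1, rfl⟩ := exists_bool_of_zero_or_one ha1
  obtain ⟨a2, rfl⟩ := exists_bool_of_zero_or_one ha2
  obtain ⟨b0, rfl⟩ := exists_bool_of_zero_or_one hb0
  obtain ⟨b1, rfl⟩ := exists_bool_of_zero_or_one hb1
  obtain ⟨b2, rfl⟩ := exists_bool_of_zero_or_one hb2
  obtain ⟨c0, rfl⟩ := exists_bool_of_zero_or_one hc0
  obtain ⟨c1, rfl⟩ := exists_bool_of_zero_or_one hc1
  obtain ⟨c2, rfl⟩ := exists_bool_of_zero_or_one hc2
  clear ha0 ha1 ha2 hb0 hb1 hb2 hc0 hc1 hc2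
  revert a0 a1 a2 b0 b1 b2 c0 c1 c2
  decide

/-- Brute force: if the squared weights of three `0/1` vectors of `ℤ³` sum to `12`, every weight
is `2`. [folklore] -/
theorem weights_of_sum_sq_eq_twelve {p0 p1 p2 q0 q1 q2 r0 r1 r2 : ℤ}
    (hp0 : p0 = 0 ∨ p0 = 1) (hp1 : p1 = 0 ∨ p1 = 1) (hp2 : p2 = 0 ∨ p2 = 1)
    (hq0 : q0 = 0 ∨ q0 = 1) (hq1 : q1 = 0 ∨ q1 = 1) (hq2 : q2 = 0 ∨ q2 = 1)
    (hr0 : r0 = 0 ∨ r0 = 1) (hr1 : r1 = 0 ∨ r1 = 1) (hr2 : r2 = 0 ∨ r2 = 1)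
    (h : (p0 + p1 + p2) ^ 2 + (q0 + q1 + q2) ^ 2 + (r0 + r1 + r2) ^ 2 = 12) :
    p0 + p1 + p2 = 2 ∧ q0 + q1 + q2 = 2 ∧ r0 + r1 + r2 = 2 := by
  obtain ⟨p0, rfl⟩ := exists_bool_of_zero_or_one hp0
  obtain ⟨p1, rfl⟩ := exists_bool_of_zero_or_one hp1
  obtain ⟨p2, rfl⟩ := exists_bool_of_zero_or_one hp2
  obtain ⟨q0, rfl⟩ := exists_bool_of_zero_or_one hq0
  obtain ⟨q1, rfl⟩ := exists_bool_of_zero_or_one hq1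
  obtain ⟨q2, rfl⟩ := exists_bool_of_zero_or_one hq2
  obtain ⟨r0, rfl⟩ := exists_bool_of_zero_or_one hr0
  obtain ⟨r1, rfl⟩ := exists_bool_of_zero_or_one hr1
  obtain ⟨r2, rfl⟩ := exists_bool_of_zero_or_one hr2
  clear hp0 hp1 hp2 hq0 hq1 hq2 hr0 hr1 hr2
  revert h p0 p1 p2 q0 q1 q2 r0 r1 r2
  decide

/-- Brute force over the `2⁴` Boolean `2 × 2` matrices with columns `a, b`: either `det = ±1`, or
one of three explicit nonzero vectors is orthogonal to both columns. [folklore] -/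
theorem dichotomy_fin_two {a0 a1 b0 b1 : ℤ}
    (ha0 : a0 = 0 ∨ a0 = 1) (ha1 : a1 = 0 ∨ a1 = 1) (hb0 : b0 = 0 ∨ b0 = 1) (hb1 : b1 = 0 ∨ b1 = 1) :
    (a0 * b1 - a1 * b0 = 1 ∨ a0 * b1 - a1 * b0 = -1) ∨
    (∃ t ∈ ([(1, 0), (0, 1), (1, -1)] : List (ℤ × ℤ)), (t.1 ≠ 0 ∨ t.2 ≠ 0) ∧
      t.1 * a0 + t.2 * a1 = 0 ∧ t.1 * b0 + t.2 * b1 = 0) := by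
  obtain ⟨a0, rfl⟩ := exists_bool_of_zero_or_one ha0
  obtain ⟨a1, rfl⟩ := exists_bool_of_zero_or_one ha1
  obtain ⟨b0, rfl⟩ := exists_bool_of_zero_or_one hb0
  obtain ⟨b1, rfl⟩ := exists_bool_of_zero_or_one hb1
  clear ha0 ha1 hb0 hb1
  revert a0 a1 b0 b1
  decide

/-! ## Unimodular `0/1` matrices: the columns span (explicit adjugate) -/

/-- Cramer / adjugate for `3 × 3`: if `det [a b c] = d` with `d² = 1` then `a, b, c` span `ℤ³`
(`d · adj · eᵢ` is an integer combination of the columns equal to `d² eᵢ = eᵢ`). [folklore] -/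
theorem span_eq_top_of_det_three (a b c : Fin 3 → ℤ) (d : ℤ)
    (hd : a 0 * (b 1 * c 2 - b 2 * c 1) - b 0 * (a 1 * c 2 - a 2 * c 1) + c 0 * (a 1 * b 2 - a 2 * b 1) = d)
    (hdd : d * d = 1) : Submodule.span ℤ {s | s ∈ [a, b, c]} = ⊤ := by
  have ha : a ∈ Submodule.span ℤ {s | s ∈ [a, b, c]} := Submodule.subset_span (by simp)
  have hb : b ∈ Submodule.span ℤ {s | s ∈ [a, b, c]} := Submodule.subset_span (by simp)
  have hc : c ∈ Submodule.span ℤ {s | s ∈ [a, b, c]} := Submodule.subset_span (by simp)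
  have hcomb : ∀ x y z : ℤ, x • a + y • b + z • c ∈ Submodule.span ℤ {s | s ∈ [a, b, c]} :=
    fun x y z => Submodule.add_mem _ (Submodule.add_mem _ (Submodule.smul_mem _ _ ha)
      (Submodule.smul_mem _ _ hb)) (Submodule.smul_mem _ _ hc)
  refine span_eq_top_of_single_mem fun i => ?_
  fin_cases i
  · convert hcomb (d * (b 1 * c 2 - b 2 * c 1)) (-(d * (a 1 * c 2 - a 2 * c 1)))
      (d * (a 1 * b 2 - a 2 * b 1)) using 1
    funext j
    fin_cases j
    · simp
      linear_combination (-d) * hd - hdd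
    · simp
      ring
    · simp
      ring
  · convert hcomb (d * (b 2 * c 0 - b 0 * c 2)) (d * (a 0 * c 2 - a 2 * c 0))
      (d * (a 2 * b 0 - a 0 * b 2)) using 1
    funext j
    fin_cases j
    · simp
      ring
    · simp
      linear_combination (-d) * hd - hdd
    · simp
      ring
  · convert hcomb (d * (b 0 * c 1 - b 1 * c 0)) (d * (a 1 * c 0 - a 0 * c 1))
      (d * (a 0 * b 1 - a 1 * b 0)) using 1
    funext j
    fin_cases j
    · simp
      ring
    · simp
      ring
    · simp
      linear_combination (-d) * hd - hdd

/-- Cramer / adjugate for `2 × 2`: if `det [a b] = d` with `d² = 1` then `a, b` span `ℤ²`.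
[folklore] -/
theorem span_eq_top_of_det_two (a b : Fin 2 → ℤ) (d : ℤ) (hd : a 0 * b 1 - a 1 * b 0 = d)
    (hdd : d * d = 1) : Submodule.span ℤ {s | s ∈ [a, b]} = ⊤ := by
  have ha : a ∈ Submodule.span ℤ {s | s ∈ [a, b]} := Submodule.subset_span (by simp)
  have hb : b ∈ Submodule.span ℤ {s | s ∈ [a, b]} := Submodule.subset_span (by simp)
  have hcomb : ∀ x y : ℤ, x • a + y • b ∈ Submodule.span ℤ {s | s ∈ [a, b]} := fun x y =>
    Submodule.add_mem _ (Submodule.smul_mem _ _ ha) (Submodule.smul_mem _ _ hb)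
  refine span_eq_top_of_single_mem fun i => ?_
  fin_cases i
  · convert hcomb (d * b 1) (-(d * a 1)) using 1
    funext j
    fin_cases j
    · simp
      linear_combination (-d) * hd - hdd
    · simp
      ring
  · convert hcomb (-(d * b 0)) (d * a 0) using 1
    funext j
    fin_cases j
    · simp
      ring
    · simp
      linear_combination (-d) * hd - hdd

end GramSpan

open GramSpan in
/-- **Helper `helper_span_eq_top_of_gram_eq` of line `Sketch` — the torsion sector is empty for at
most three holes.**  Let `n ≤ 3` and let `sA`, `sB` be two lists of `n` nonzero `0/1` vectors of
`ℤⁿ` (the types of the vanishing cycles of two positive factorisations of one planar mapping class)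
with the same Gram sum `Σ_{s ∈ sA} sᵢ sⱼ = Σ_{s ∈ sB} sᵢ sⱼ` (abelianised arc data) such that
`sA ++ sB` spans `ℤⁿ` (`π₁ = 1`).  Then `sA` alone spans `ℤⁿ` (`H₁(X_A; ℤ) = 0`). [folklore] -/
theorem helper_span_eq_top_of_gram_eq (n : ℕ) (hn : n ≤ 3) (sA sB : List (Fin n → ℤ))
    (hA : sA.length = n) (hB : sB.length = n)
    (h01 : ∀ s ∈ sA ++ sB, ∀ i, s i = 0 ∨ s i = 1) (hne : ∀ s ∈ sA ++ sB, s ≠ 0)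
    (hgram : ∀ i j : Fin n, (sA.map fun s => s i * s j).sum = (sB.map fun s => s i * s j).sum)
    (hspan : Submodule.span ℤ {s | s ∈ sA ++ sB} = ⊤) :
    Submodule.span ℤ {s | s ∈ sA} = ⊤ := by
  -- a functional that is `m`-divisible on `sA` and on `sB` is `m`-divisible on the basis
  have kill : ∀ (m : ℤ) (w : Fin n → ℤ), (∀ s ∈ sA, m ∣ w ⬝ᵥ s) → (∀ s ∈ sB, m ∣ w ⬝ᵥ s) →
      ∀ i, m ∣ w i :=
    fun m w hwA hwB => dvd_apply_of_span_eq_top hspan m w fun s hs => by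
      rcases List.mem_append.1 hs with h | h
      exacts [hwA s h, hwB s h]
  -- a functional killing `sA` kills `sB` (Gram), hence vanishes
  have kill0 : ∀ w : Fin n → ℤ, (∀ s ∈ sA, w ⬝ᵥ s = 0) → w = 0 := by
    intro w hw
    funext i
    exact zero_dvd_iff.1 (kill 0 w (fun s hs => by rw [hw s hs])
      (fun s hs => by rw [dot_eq_zero_of_gram_eq hgram w hw s hs]) i)
  obtain rfl | rfl | rfl | rfl : n = 0 ∨ n = 1 ∨ n = 2 ∨ n = 3 := by omega
  · -- `n = 0`: nothing to span
    exact span_eq_top_of_single_mem fun i => i.elim0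
  · -- `n = 1`: the single type is `e₀`
    obtain ⟨a, rfl⟩ := List.length_eq_one_iff.1 hA
    have ha : a 0 = 1 := by
      rcases h01 a (by simp) 0 with h | h
      · exact absurd (funext fun i => by rw [Subsingleton.elim i 0, h]; rfl) (hne a (by simp))
      · exact h
    refine span_eq_top_of_single_mem fun i => ?_
    have hi : Pi.single i (1 : ℤ) = a := by
      funext j
      rw [Subsingleton.elim i 0, Subsingleton.elim j 0, ha]
      simp
    rw [hi]
    exact Submodule.subset_span (by simp)
  · -- `n = 2`
    obtain ⟨a, b, rfl⟩ := List.length_eq_two.1 hA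
    have h01a := h01 a (by simp)
    have h01b := h01 b (by simp)
    rcases dichotomy_fin_two (h01a 0) (h01a 1) (h01b 0) (h01b 1) with hi | hii
    · exact span_eq_top_of_det_two a b _ rfl (by rcases hi with h | h <;> rw [h] <;> norm_num)
    · exfalso
      obtain ⟨⟨w0, w1⟩, -, hw, hwa, hwb⟩ := hii
      simp only at hw hwa hwb
      have hk := kill0 ![w0, w1] (by
        intro s hs
        simp only [List.mem_cons, List.not_mem_nil, or_false] at hs
        rcases hs with rfl | rfl <;> simp [dotProduct, Fin.sum_univ_two] <;> linarith)
      have e0 := congrFun hk 0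
      have e1 := congrFun hk 1
      simp only [cons_val_zero, cons_val_one, Pi.zero_apply] at e0 e1
      omega
  · -- `n = 3`
    obtain ⟨a, b, c, rfl⟩ := List.length_eq_three.1 hA
    obtain ⟨p, q, r, rfl⟩ := List.length_eq_three.1 hB
    have h01a := h01 a (by simp)
    have h01b := h01 b (by simp)
    have h01c := h01 c (by simp)
    have h01p := h01 p (by simp)
    have h01q := h01 q (by simp)
    have h01r := h01 r (by simp)
    rcases trichotomy_fin_three (h01a 0) (h01a 1) (h01a 2) (h01b 0) (h01b 1) (h01b 2) (h01c 0)
      (h01c 1) (h01c 2) with hi | hii | hiii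
    · -- (i) `det = ±1`: the columns span
      exact span_eq_top_of_det_three a b c _ rfl (by rcases hi with h | h <;> rw [h] <;> norm_num)
    · -- (ii) a nonzero functional kills `a, b, c`, hence `sB`, hence is zero
      exfalso
      obtain ⟨⟨w0, w1, w2⟩, -, hw, hwa, hwb, hwc⟩ := hii
      simp only at hw hwa hwb hwc
      have hk := kill0 ![w0, w1, w2] (by
        intro s hs
        simp only [List.mem_cons, List.not_mem_nil, or_false] at hs
        rcases hs with rfl | rfl | rfl <;> simp [dotProduct, Fin.sum_univ_three] <;> linarith)
      have e0 := congrFun hk 0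
      have e1 := congrFun hk 1
      have e2 := congrFun hk 2
      simp only [cons_val_zero, cons_val_one, cons_val, Pi.zero_apply] at e0 e1 e2
      omega
    · -- (iii) all of `a, b, c` have weight `2`: parity obstruction with `w = (1, 1, 1)`
      exfalso
      obtain ⟨hwa, hwb, hwc⟩ := hiii
      have hsq := sum_sq_eq_of_gram_eq hgram (fun _ => 1)
      simp only [List.map_cons, List.map_nil, List.sum_cons, List.sum_nil, add_zero, dotProduct,
        Fin.sum_univ_three, one_mul, hwa, hwb, hwc] at hsq
      obtain ⟨hwp, hwq, hwr⟩ := weights_of_sum_sq_eq_twelve (h01p 0) (h01p 1) (h01p 2) (h01q 0)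
        (h01q 1) (h01q 2) (h01r 0) (h01r 1) (h01r 2) (by linarith)
      have h2 := kill 2 (fun _ => 1)
        (by
          intro s hs
          simp only [List.mem_cons, List.not_mem_nil, or_false] at hs
          rcases hs with rfl | rfl | rfl <;> simp [dotProduct, Fin.sum_univ_three, hwa, hwb, hwc])
        (by
          intro s hs
          simp only [List.mem_cons, List.not_mem_nil, or_false] at hs
          rcases hs with rfl | rfl | rfl <;> simp [dotProduct, Fin.sum_univ_three, hwp, hwq, hwr])
        0
      norm_num at h2

end Summit.SmoothPoincare4.SmoothPoincare4.Theorems.PlanarAcyclicBisectionRigidity.Sketch
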